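import Literature.Computability.Complexity.CookLevinTableau
import Literature.Computability.Complexity.GenProgramsInput
import Literature.Computability.Complexity.StackArith
import Literature.Computability.Complexity.NPClosureProofs
import Mathlib.Algebra.Polynomial.Eval.Defs
import HarnessLib

/-!
# The Cook–Levin theorem for `TAUT`: every language in `coNP` Karp-reduces to `TAUT`

Discharge of the machine-level content of `isComplete_coNP_TAUT` (`ProofComplexityProofs.lean`;
Arora–Barak 2009, Example 2.21: "`TAUTOLOGY` is coNP-complete … modify the Cook–Levin
reduction") for the H21 classes over Mathlib's `Turing.TM2`:
`isHard_coNP_TAUT_holds : IsHard coNP TAUT`, i.e. every `L ∈ coNP` satisfies `L ≤ₚ TAUT`.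

Given `L ∈ coNP`, i.e. `Lᶜ ∈ NP = polyExists P`: `x ∈ Lᶜ ↔ ∃ u, |u| ≤ p |x| ∧ ⟨x, u⟩ ∈ L'`
with `L' ∈ P` decided by a polynomial-time `FinTM2` machine `M` (`mem_P_iff_holds`), the
reduction is `x ↦ encode (¬ χₓ)` where `χₓ` is the Cook–Levin tableau CNF of
`CookLevinTableau.lean` (satisfiable iff some certificate is accepted,
`Tableau.satisfiable_tableau_iff`) with its block variables renamed into `ℕ`; so
`x ∈ L ↔ χₓ` unsatisfiable `↔ ¬χₓ ∈ TAUT` (Cook 1971, Thm. 1; Arora–Barak 2009, Thm. 2.10 and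
Example 2.21; Sipser 2012, Thm. 7.37).

**Polynomial time** (Arora–Barak 2009, proof of Lemma 2.11, PDF p. 72: "this CNF formula can
be computed in time polynomial in the running time of `M`"; Sipser 2012, proof of Thm. 7.37,
last paragraph) is obtained from the generator programs with input access of
`GenProgramsInput.lean` — no machine is written here:

* variables are renamed to numbers `uname m = 2ᵐ - 1`, whose Mathlib code `encodeNat` is the
  unary word `1ᵐ` (`encodeNat_uname`), so that the prefix code of every node of `¬χₓ` is a word a
  counter program can emit;
* a small *clause schema* language `Sch` (blocks of clauses with counter expressions for the
  block numbers, sequencing, counted loops) is interpreted both as a clause list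
  (`Sch.clauses`, shown equal to the clause families of `CookLevinTableau.lean`) and as a
  generator statement (`Sch.stmt`, emitting the prefix code of `PropForm.ofCNF` clause by
  clause: `code_ofCNF`, `mapVars_ofCNF`), with one correspondence theorem (`Sch.out_stmt`) and
  a size expression (`Sch.sizeE`, `size_ofCNF`, for the unary length header of
  `encodingPropForm`);
* the two unit clauses per input bit are emitted by the bit loop, everything else depends on
  `|x|` only; `GenProg.outI_mem_FP` gives `(x ↦ encode (¬χₓ)) ∈ FP` (`reduce_mem_FP`).

## References

* S. A. Cook, *The complexity of theorem-proving procedures*, Proc. 3rd STOC (1971), Thm. 1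
  (every language in NP reduces to `{DNF tautologies}`).
* S. Arora, B. Barak, *Computational Complexity: A Modern Approach*, CUP 2009, Thm. 2.10,
  Lemma 2.11, Example 2.21.
* M. Sipser, *Introduction to the Theory of Computation*, 3rd ed., 2012, Thm. 7.37.
* R. M. Karp, *Reducibility among combinatorial problems*, 1972, §4.
-/

namespace Literature.Computability.Complexity

open _root_.Computability Polynomial

namespace CookLevin

/-! ### Unary variable names -/

/-- The variable name with unary binary code: `uname m = 2ᵐ - 1`, i.e. the number whose bits
are `1ᵐ`. [folklore] -/
def uname (m : ℕ) : ℕ := bitsToNat (List.replicate m true)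

/-- The normal form of `1ᵐ` is `1ᵐ`. [folklore] -/
theorem norm_replicate_true : ∀ m : ℕ, norm (List.replicate m true) = List.replicate m true
  | 0 => rfl
  | m + 1 => by
    rw [List.replicate_succ, norm_cons, norm_replicate_true m]
    cases m <;> simp [List.replicate_succ]

/-- **Mathlib's binary code of `uname m` is the unary word `1ᵐ`.** [folklore] -/
theorem encodeNat_uname (m : ℕ) : encodeNat (uname m) = List.replicate m true := by
  rw [uname, ← norm_eq_encodeNat, norm_replicate_true]

/-- `uname` is injective. [folklore] -/
theorem uname_injective : Function.Injective uname := by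
  intro a b h
  have := congrArg (fun k => (encodeNat k).length) h
  simpa [encodeNat_uname] using this

/-- Doubling the bits of `1ʳ` gives `1²ʳ`. [folklore] -/
theorem flatMap_dup_replicate (r : ℕ) :
    ((List.replicate r true).flatMap fun b => [b, b]) = List.replicate (2 * r) true := by
  induction r with
  | zero => rfl
  | succ r ih =>
    rw [List.replicate_succ, List.flatMap_cons, ih, show 2 * (r + 1) = 2 * r + 1 + 1 by ring,
      List.replicate_succ, List.replicate_succ]
    rfl

/-- `boolPair 1ʳ y = 1²ʳ 01 y`. [folklore] -/
theorem boolPair_replicate_true (r : ℕ) (y : List Bool) :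
    boolPair (List.replicate r true) y = List.replicate (2 * r) true ++ [false, true] ++ y := by
  rw [boolPair, flatMap_dup_replicate]

/-! ### Satisfiability under relabelling -/

section MapVars

variable {ν μ : Type}

/-- A relabelled formula is satisfiable only if the original is. [folklore] -/
theorem _root_.Literature.Computability.Complexity.PropForm.Satisfiable.of_mapVars (f : ν → μ) {φ : PropForm ν}
    (h : (φ.mapVars f).Satisfiable) : φ.Satisfiable := by
  obtain ⟨σ, hσ⟩ := h
  exact ⟨σ ∘ f, by rwa [PropForm.eval_mapVars] at hσ⟩

/-- Along an injective relabelling satisfiability is preserved. [folklore] -/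
theorem _root_.Literature.Computability.Complexity.PropForm.Satisfiable.mapVars {f : ν → μ} (hf : Function.Injective f)
    {φ : PropForm ν} (h : φ.Satisfiable) : (φ.mapVars f).Satisfiable := by
  classical
  obtain ⟨σ, hσ⟩ := h
  refine ⟨Function.extend f σ (fun _ => false), ?_⟩
  rw [PropForm.eval_mapVars]
  have : Function.extend f σ (fun _ => false) ∘ f = σ := funext fun a => hf.extend_apply _ _ a
  rw [this, hσ]

end MapVars

/-! ### Prefix codes and sizes of `PropForm.ofCNF` -/

section Codes

variable {ν μ : Type}

/-- The formula of a literal (as in `PropForm.ofCNF`): `x` or `¬x`. [Arora–Barak 2009, Def. 2.9] [folklore] -/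
def litForm (l : Literal ν) : PropForm ν :=
  if l.2 then PropForm.var l.1 else PropForm.neg (PropForm.var l.1)

/-- The formula of a clause (the inner fold of `PropForm.ofCNF`): `l₁ ∨ (l₂ ∨ (… ∨ ⊥))`.
[Arora–Barak 2009, Def. 2.9] [folklore] -/
def clauseForm (c : Clause ν) : PropForm ν :=
  c.foldr (fun l d => PropForm.disj (litForm l) d) (PropForm.const false)

/-- `PropForm.ofCNF` is the right fold of the clause formulas. [folklore] -/
theorem ofCNF_eq (φ : CNF ν) :
    PropForm.ofCNF φ = φ.foldr (fun c acc => PropForm.conj (clauseForm c) acc) (PropForm.const true) :=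
  rfl

/-- Relabelling a literal. [folklore] -/
def renLit (f : ν → μ) (l : Literal ν) : Literal μ := (f l.1, l.2)

/-- Relabelling a literal formula. [folklore] -/
theorem mapVars_litForm (f : ν → μ) (l : Literal ν) : (litForm l).mapVars f = litForm (renLit f l) := by
  unfold litForm renLit
  cases l.2 <;> rfl

/-- Relabelling a clause formula. [folklore] -/
theorem mapVars_clauseForm (f : ν → μ) (c : Clause ν) :
    (clauseForm c).mapVars f = clauseForm (c.map (renLit f)) := by
  induction c with
  | nil => rfl
  | cons l c ih =>
    simp only [clauseForm, List.foldr_cons, List.map_cons, PropForm.mapVars] at ih ⊢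
    rw [ih, mapVars_litForm]

/-- **Relabelling `PropForm.ofCNF` relabels the CNF.** [folklore] -/
theorem mapVars_ofCNF (f : ν → μ) (φ : CNF ν) :
    (PropForm.ofCNF φ).mapVars f = PropForm.ofCNF (φ.map fun c => c.map (renLit f)) := by
  rw [ofCNF_eq, ofCNF_eq]
  induction φ with
  | nil => rfl
  | cons c φ ih =>
    simp only [List.foldr_cons, List.map_cons, PropForm.mapVars] at ih ⊢
    rw [ih, mapVars_clauseForm]

/-- Size of a literal formula: `1` or `2`. [folklore] -/
theorem size_litForm (l : Literal ν) : (litForm l).size = if l.2 then 1 else 2 := by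
  unfold litForm
  cases l.2 <;> rfl

/-- Size of a clause formula. [folklore] -/
theorem size_clauseForm (c : Clause ν) :
    (clauseForm c).size = (c.map fun l => (litForm l).size + 1).sum + 1 := by
  induction c with
  | nil => rfl
  | cons l c ih =>
    simp only [clauseForm, List.foldr_cons, PropForm.size, List.map_cons, List.sum_cons] at ih ⊢
    omega

/-- **Size of `PropForm.ofCNF`.** [folklore] -/
theorem size_ofCNF (φ : CNF ν) :
    (PropForm.ofCNF φ).size = (φ.map fun c => (clauseForm c).size + 1).sum + 1 := by
  rw [ofCNF_eq]
  induction φ with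
  | nil => rfl
  | cons c φ ih =>
    simp only [List.foldr_cons, PropForm.size, List.map_cons, List.sum_cons] at ih ⊢
    omega

/-- Size of the clause formula of a premise/conclusion clause: `3|premises| + 2|conclusions| + 1`.
[folklore] -/
theorem size_clauseForm_toClause {W : Type} (cl : HClause W) :
    (clauseForm (HClause.toClause cl)).size = 3 * cl.1.length + 2 * cl.2.length + 1 := by
  rw [size_clauseForm, HClause.toClause, List.map_append, List.sum_append, List.map_map,
    List.map_map]
  have h1 : ∀ l : List W, (l.map ((fun l => (litForm l).size + 1) ∘ fun v => (v, false))).sum =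
      3 * l.length := fun l => by
    induction l with
    | nil => rfl
    | cons a l ih => simp [size_litForm] at ih ⊢; omega
  have h2 : ∀ l : List W, (l.map ((fun l => (litForm l).size + 1) ∘ fun v => (v, true))).sum =
      2 * l.length := fun l => by
    induction l with
    | nil => rfl
    | cons a l ih => simp [size_litForm] at ih ⊢; omega
  rw [h1, h2]

/-- Code of a literal formula. [folklore] -/
theorem code_litForm (l : Literal ℕ) :
    (litForm l).code = (if l.2 then [] else [true, false]) ++ (PropForm.var l.1).code := by
  unfold litForm
  cases l.2 <;> rfl

/-- Code of a clause formula: `111 · code l` per literal, then `010`. [folklore] -/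
theorem code_clauseForm (c : Clause ℕ) :
    (clauseForm c).code = (c.flatMap fun l => [true, true, true] ++ (litForm l).code) ++
      [false, true, false] := by
  induction c with
  | nil => rfl
  | cons l c ih =>
    simp only [clauseForm, List.foldr_cons, PropForm.code, List.flatMap_cons] at ih ⊢
    rw [ih]; simp

/-- **Code of `PropForm.ofCNF`**: `110 · code (clauseForm c)` per clause, then `011`. [folklore] -/
theorem code_ofCNF (φ : CNF ℕ) :
    (PropForm.ofCNF φ).code = (φ.flatMap fun c => [true, true, false] ++ (clauseForm c).code) ++
      [false, true, true] := by
  rw [ofCNF_eq]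
  induction φ with
  | nil => rfl
  | cons c φ ih =>
    simp only [List.foldr_cons, PropForm.code, List.flatMap_cons] at ih ⊢
    rw [ih]; simp

/-- Code of a variable with a unary name: `00 1²ᵐ 01`. [folklore] -/
theorem code_var_uname (m : ℕ) :
    (PropForm.var (uname m)).code = [false, false] ++ List.replicate (2 * m) true ++ [false, true] := by
  simp [PropForm.code, encodeNat_uname, boolPair_replicate_true]

end Codes

/-! ### Clause schemata: clause lists and their generator statements -/

/-- A clause with block numbers given by counter expressions: premises and conclusions, each a
pair (block expression, value). [folklore] -/
abbrev ClauseE (V W : Type) : Type := List (GExpr V × W) × List (GExpr V × W)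

/-- Clause schemata: a block of expression clauses, sequencing, and the counted loop
`loop i e s` ("for `i < e` do `s`"). [Arora–Barak 2009, Lemma 2.11 (proof)] [folklore] -/
inductive Sch (V W : Type) where
  /-- a block of clauses -/
  | cls (L : List (ClauseE V W))
  /-- sequence -/
  | seq (a b : Sch V W)
  /-- counted loop -/
  | loop (i : V) (e : GExpr V) (body : Sch V W)

namespace Sch

variable {V W : Type} [DecidableEq V]

/-- The clause of an expression clause in an environment. [folklore] -/
def evalCl (env : V → ℕ) (c : ClauseE V W) : HClause (ℕ × W) :=
  (c.1.map fun q => (q.1.eval env, q.2), c.2.map fun q => (q.1.eval env, q.2))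

/-- **The clause list of a schema.** [folklore] -/
def clauses : Sch V W → (V → ℕ) → List (HClause (ℕ × W))
  | cls L, env => L.map (evalCl env)
  | seq a b, env => a.clauses env ++ b.clauses env
  | loop i e body, env => (List.range (e.eval env)).flatMap fun k =>
      body.clauses (Function.update env i k)

omit [DecidableEq V] in
/-- The loop indices of a schema. [folklore] -/
def idxs : Sch V W → List V
  | cls _ => []
  | seq a b => a.idxs ++ b.idxs
  | loop i _ body => i :: body.idxs

section Stmt

variable (MM : ℕ) (idxW : W → ℕ) (rr : V)

/-- The renaming of block variables into unary names: `(b, w) ↦ uname (b · MM + idx w)`.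
[folklore] -/
def ren (bw : ℕ × W) : ℕ := uname (bw.1 * MM + idxW bw.2)

/-- The generator statement emitting the code of the literal `(e, w)`:
`00 1^(2 (e MM + idx w)) 01`, the run of ones by a counted loop on the index `rr`. [folklore] -/
def varStmt (e : GExpr V) (w : W) : GStmt V Bool :=
  GStmt.seq (GStmt.emit [false, false])
    (GStmt.seq (GStmt.loop rr (GExpr.mul (GExpr.const 2)
      (GExpr.add (GExpr.mul e (GExpr.const MM)) (GExpr.const (idxW w)))) (GStmt.emit [true]))
      (GStmt.emit [false, true]))

/-- The generator statement emitting `111` and the code of the literal `(ren (e, w), b)`.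
[folklore] -/
def litStmt (b : Bool) (e : GExpr V) (w : W) : GStmt V Bool :=
  GStmt.seq (GStmt.emit ([true, true, true] ++ if b then [] else [true, false])) (varStmt MM idxW rr e w)

/-- The generator statement emitting the literals of one polarity. [folklore] -/
def litsStmt (b : Bool) : List (GExpr V × W) → GStmt V Bool
  | [] => GStmt.emit []
  | q :: l => GStmt.seq (litStmt MM idxW rr b q.1 q.2) (litsStmt b l)

/-- The generator statement emitting `110` and the code of the clause formula of an expression
clause (negative literals, positive literals, `010`). [folklore] -/
def clauseStmt (c : ClauseE V W) : GStmt V Bool :=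
  GStmt.seq (GStmt.emit [true, true, false]) (GStmt.seq (litsStmt MM idxW rr false c.1)
    (GStmt.seq (litsStmt MM idxW rr true c.2) (GStmt.emit [false, true, false])))

/-- Sequence of a list of generator statements. [folklore] -/
def stmts : List (GStmt V Bool) → GStmt V Bool
  | [] => GStmt.emit []
  | s :: l => GStmt.seq s (stmts l)

/-- **The generator statement of a schema.** [Arora–Barak 2009, Lemma 2.11 (proof)] [folklore] -/
def stmt : Sch V W → GStmt V Bool
  | cls L => stmts (L.map (clauseStmt MM idxW rr))
  | seq a b => GStmt.seq (a.stmt) (b.stmt)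
  | loop i e body => GStmt.loop i e body.stmt

/-- The conjunct code of a clause after renaming: `110 · code (clauseForm (toClause cl))`.
[folklore] -/
def clCode (cl : HClause (ℕ × W)) : List Bool :=
  [true, true, false] ++ (clauseForm ((HClause.toClause cl).map (renLit (ren MM idxW)))).code

/-! #### Correspondence -/

omit [DecidableEq V] in
/-- Emitting one `1` per round of a counted loop emits a run of ones. [folklore] -/
theorem flatMap_range_true (N : ℕ) :
    ((List.range N).flatMap fun _ => [true]) = List.replicate N true := by
  induction N with
  | zero => rfl
  | succ n ih => rw [List.range_succ, List.flatMap_append, ih, List.replicate_succ']; simp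

/-- `varStmt` emits the code of the renamed literal. [folklore] -/
theorem out_varStmt (e : GExpr V) (w : W) (env : V → ℕ) :
    (varStmt MM idxW rr e w).out env = (PropForm.var (ren MM idxW (e.eval env, w))).code := by
  simp only [ren]
  rw [code_var_uname]
  simp [varStmt, GStmt.out, flatMap_range_true, GExpr.eval]

/-- `litsStmt` emits the literal codes with their `111` tags. [folklore] -/
theorem out_litsStmt (b : Bool) (env : V → ℕ) : ∀ l : List (GExpr V × W),
    (litsStmt MM idxW rr b l).out env = (l.map fun q => (ren MM idxW (q.1.eval env, q.2), b)).flatMap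
      fun lit => [true, true, true] ++ (litForm lit).code
  | [] => rfl
  | q :: l => by
    rw [litsStmt, GStmt.out, out_litsStmt b env l, List.map_cons, List.flatMap_cons]
    congr 1
    rw [litStmt, GStmt.out, out_varStmt, code_litForm]
    cases b <;> simp [GStmt.out]

/-- `clauseStmt` emits the conjunct code of the evaluated clause. [folklore] -/
theorem out_clauseStmt (env : V → ℕ) (c : ClauseE V W) :
    (clauseStmt MM idxW rr c).out env = clCode MM idxW (evalCl env c) := by
  rw [clCode, code_clauseForm]
  simp only [clauseStmt, GStmt.out, out_litsStmt, evalCl, HClause.toClause, List.map_append,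
    List.map_map, Function.comp_def, renLit, List.flatMap_append, List.append_assoc]

/-- `stmts` emits the concatenation. [folklore] -/
theorem out_stmts (env : V → ℕ) : ∀ l : List (GStmt V Bool),
    (stmts l).out env = l.flatMap fun s => s.out env
  | [] => rfl
  | s :: l => by rw [stmts, GStmt.out, out_stmts env l, List.flatMap_cons]

/-- **Correspondence**: the statement of a schema emits the conjunct codes of its clauses, in
order. [Arora–Barak 2009, Lemma 2.11 (proof)] [folklore] -/
theorem out_stmt : ∀ (s : Sch V W) (env : V → ℕ),
    (s.stmt MM idxW rr).out env = (s.clauses env).flatMap (clCode MM idxW)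
  | cls L, env => by
    rw [stmt, out_stmts, clauses, List.flatMap_map]
    simp only [List.flatMap_map, out_clauseStmt]
  | seq a b, env => by
    rw [stmt, GStmt.out, out_stmt a, out_stmt b, clauses, List.flatMap_append]
  | loop i e body, env => by
    rw [stmt, GStmt.out, clauses, List.flatMap_assoc]
    congr 1
    funext k
    exact out_stmt body _

/-! #### Loop variables of schema statements -/

omit [DecidableEq V] in
/-- Loop indices of `stmts`. [folklore] -/
theorem loopVars_stmts : ∀ l : List (GStmt V Bool),
    (stmts l).loopVars = l.flatMap GStmt.loopVars
  | [] => rfl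
  | s :: l => by rw [stmts, GStmt.loopVars, loopVars_stmts l, List.flatMap_cons]

omit [DecidableEq V] in
/-- The only loop index of `varStmt` is `rr`. [folklore] -/
theorem loopVars_varStmt (e : GExpr V) (w : W) : (varStmt MM idxW rr e w).loopVars = [rr] := rfl

omit [DecidableEq V] in
/-- The loop indices of `litsStmt` are copies of `rr`. [folklore] -/
theorem mem_loopVars_litsStmt {v : V} (b : Bool) : ∀ {l : List (GExpr V × W)},
    v ∈ (litsStmt MM idxW rr b l).loopVars → v = rr
  | [], h => by simp [litsStmt, GStmt.loopVars] at h
  | q :: l, h => by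
    simp only [litsStmt, litStmt, GStmt.loopVars, loopVars_varStmt, List.mem_append,
      List.mem_singleton, List.not_mem_nil, false_or] at h
    rcases h with h | h
    · exact h
    · exact mem_loopVars_litsStmt b h

omit [DecidableEq V] in
/-- **Loop indices of a schema statement**: the loop indices of the schema, and `rr`. [folklore] -/
theorem mem_loopVars_stmt {v : V} : ∀ {s : Sch V W},
    v ∈ (s.stmt MM idxW rr).loopVars → v = rr ∨ v ∈ s.idxs
  | cls L, h => by
    left
    rw [stmt, loopVars_stmts, List.mem_flatMap] at h
    obtain ⟨s, hs, hv⟩ := h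
    obtain ⟨c, -, rfl⟩ := List.mem_map.1 hs
    simp only [clauseStmt, GStmt.loopVars, List.nil_append, List.mem_append, List.append_nil] at hv
    rcases hv with hv | hv
    · exact mem_loopVars_litsStmt MM idxW rr false hv
    · exact mem_loopVars_litsStmt MM idxW rr true hv
  | seq a b, h => by
    simp only [stmt, GStmt.loopVars, List.mem_append, idxs] at h ⊢
    rcases h with h | h
    · rcases mem_loopVars_stmt h with h | h
      · exact Or.inl h
      · exact Or.inr (Or.inl h)
    · rcases mem_loopVars_stmt h with h | h
      · exact Or.inl h
      · exact Or.inr (Or.inr h)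
  | loop i e body, h => by
    simp only [stmt, GStmt.loopVars, List.mem_cons, idxs] at h ⊢
    rcases h with h | h
    · exact Or.inr (Or.inl h)
    · rcases mem_loopVars_stmt h with h | h
      · exact Or.inl h
      · exact Or.inr (Or.inr h)

/-- Well-formedness of a schema for compilation: every loop index differs from `rr` and is not
reused inside its body. [folklore] -/
def ok : Sch V W → Prop
  | cls _ => True
  | seq a b => a.ok ∧ b.ok
  | loop i _ body => i ≠ rr ∧ i ∉ body.idxs ∧ body.ok

/-- `stmts` of statements without reuse has no reuse. [folklore] -/
theorem noReuse_stmts : ∀ {l : List (GStmt V Bool)}, (∀ s ∈ l, s.noReuse = true) →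
    (stmts l).noReuse = true
  | [], _ => rfl
  | s :: l, h => by
    simp only [stmts, GStmt.noReuse, Bool.and_eq_true]
    exact ⟨h s (List.mem_cons_self ..), noReuse_stmts fun s' hs' => h s' (List.mem_cons_of_mem _ hs')⟩

/-- `varStmt` has no reuse. [folklore] -/
theorem noReuse_varStmt (e : GExpr V) (w : W) : (varStmt MM idxW rr e w).noReuse = true := by
  simp [varStmt, GStmt.noReuse, GStmt.loopVars]

/-- `litsStmt` has no reuse. [folklore] -/
theorem noReuse_litsStmt (b : Bool) : ∀ l : List (GExpr V × W), (litsStmt MM idxW rr b l).noReuse = true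
  | [] => rfl
  | q :: l => by
    simp only [litsStmt, litStmt, GStmt.noReuse, noReuse_varStmt, noReuse_litsStmt b l, Bool.and_self]

/-- **A well-formed schema compiles to a statement without reuse of loop indices.** [folklore] -/
theorem noReuse_stmt : ∀ {s : Sch V W}, s.ok rr → (s.stmt MM idxW rr).noReuse = true
  | cls L, _ => by
    refine noReuse_stmts fun s hs => ?_
    obtain ⟨c, -, rfl⟩ := List.mem_map.1 hs
    simp only [clauseStmt, GStmt.noReuse, noReuse_litsStmt, Bool.and_self]
  | seq a b, h => by
    simp only [stmt, GStmt.noReuse, Bool.and_eq_true]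
    exact ⟨noReuse_stmt h.1, noReuse_stmt h.2⟩
  | loop i e body, h => by
    simp only [stmt, GStmt.noReuse, Bool.and_eq_true, decide_eq_true_eq]
    refine ⟨fun hm => ?_, noReuse_stmt h.2.2⟩
    rcases mem_loopVars_stmt MM idxW rr hm with h' | h'
    · exact h.1 h'
    · exact h.2.1 h'

/-! #### Sizes -/

/-- The size expression of a schema: the sum of `size (clauseForm (toClause cl)) + 1` over its
clauses, as a counter expression (valid when loop bounds do not mention loop indices,
`BoundsFree`). [folklore] -/
def sizeE : Sch V W → GExpr V
  | cls L => GExpr.const (L.map fun c => 3 * c.1.length + 2 * c.2.length + 2).sum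
  | seq a b => GExpr.add a.sizeE b.sizeE
  | loop _ e body => GExpr.mul e body.sizeE

omit [DecidableEq V] in
/-- The variables of a counter expression. [folklore] -/
def _root_.Literature.Computability.Complexity.GExpr.vars : GExpr V → List V
  | GExpr.const _ => []
  | GExpr.var x => [x]
  | GExpr.add a b => a.vars ++ b.vars
  | GExpr.mul a b => a.vars ++ b.vars

/-- An expression not mentioning `i` is unchanged by updating `i`. [folklore] -/
theorem _root_.Literature.Computability.Complexity.GExpr.eval_update_of_not_mem {i : V} (env : V → ℕ) (k : ℕ) :
    ∀ {e : GExpr V}, i ∉ e.vars → e.eval (Function.update env i k) = e.eval env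
  | GExpr.const _, _ => rfl
  | GExpr.var x, h => by
    simp only [GExpr.vars, List.mem_singleton] at h
    simp [GExpr.eval, Function.update_of_ne (Ne.symm h)]
  | GExpr.add a b, h => by
    simp only [GExpr.vars, List.mem_append, not_or] at h
    simp [GExpr.eval, GExpr.eval_update_of_not_mem env k h.1, GExpr.eval_update_of_not_mem env k h.2]
  | GExpr.mul a b, h => by
    simp only [GExpr.vars, List.mem_append, not_or] at h
    simp [GExpr.eval, GExpr.eval_update_of_not_mem env k h.1, GExpr.eval_update_of_not_mem env k h.2]

omit [DecidableEq V] in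
/-- `BoundsFree F s`: every loop bound of `s` mentions only variables in `F` ("free"
variables, never used as loop indices), and no loop index is in `F`. [folklore] -/
def BoundsFree (F : V → Prop) : Sch V W → Prop
  | cls _ => True
  | seq a b => BoundsFree F a ∧ BoundsFree F b
  | loop i e body => ¬ F i ∧ (∀ v ∈ e.vars, F v) ∧ (∀ v ∈ body.sizeE.vars, F v) ∧ BoundsFree F body

/-- The size expression of a `BoundsFree` schema is invariant under updating a loop index.
[folklore] -/
theorem eval_sizeE_update {F : V → Prop} {i : V} (hi : ¬ F i) (env : V → ℕ) (k : ℕ) :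
    ∀ {s : Sch V W}, (∀ v ∈ s.sizeE.vars, F v) →
      s.sizeE.eval (Function.update env i k) = s.sizeE.eval env :=
  fun h => GExpr.eval_update_of_not_mem env k fun hm => hi (h _ hm)

/-- **The size expression computes the clause sizes**: for a `BoundsFree` schema,
`Σ_{cl ∈ clauses} (size (clauseForm (toClause cl)) + 1) = sizeE`. [folklore] -/
theorem sum_size_clauses {F : V → Prop} : ∀ {s : Sch V W} (_ : s.BoundsFree F) (env : V → ℕ),
    ((s.clauses env).map fun cl => (clauseForm (HClause.toClause cl)).size + 1).sum = s.sizeE.eval env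
  | cls L, _, env => by
    simp only [clauses, sizeE, GExpr.eval, List.map_map]
    congr 1
    refine List.map_congr_left fun c _ => ?_
    simp [size_clauseForm_toClause, evalCl]
  | seq a b, h, env => by
    simp only [clauses, sizeE, GExpr.eval, List.map_append, List.sum_append,
      sum_size_clauses h.1, sum_size_clauses h.2]
  | loop i e body, h, env => by
    obtain ⟨hi, -, hsz, hb⟩ := h
    simp only [clauses, sizeE, GExpr.eval]
    generalize e.eval env = N
    induction N with
    | zero => simp
    | succ N ih =>
      rw [List.range_succ, List.flatMap_append, List.map_append, List.sum_append, ih,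
        List.flatMap_singleton, sum_size_clauses hb, eval_sizeE_update hi env N hsz]
      ring

end Stmt

end Sch

/-! ### Counter expressions for polynomials -/

namespace GE

variable {V : Type}

/-- Powers of a counter expression. [folklore] -/
def pow (e : GExpr V) : ℕ → GExpr V
  | 0 => GExpr.const 1
  | i + 1 => GExpr.mul (pow e i) e

/-- A polynomial over `ℕ` evaluated at a counter expression, as a counter expression. [folklore] -/
noncomputable def poly (r : Polynomial ℕ) (e : GExpr V) : GExpr V :=
  (List.range (r.natDegree + 1)).foldr
    (fun i acc => GExpr.add (GExpr.mul (GExpr.const (r.coeff i)) (pow e i)) acc) (GExpr.const 0)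

/-- Value of a power expression. [folklore] -/
@[simp] theorem eval_pow (e : GExpr V) (env : V → ℕ) : ∀ i, (pow e i).eval env = e.eval env ^ i
  | 0 => rfl
  | i + 1 => by rw [pow, GExpr.eval, eval_pow e env i, pow_succ]

/-- Value of a polynomial expression: the polynomial at the value. [folklore] -/
@[simp] theorem eval_poly (r : Polynomial ℕ) (e : GExpr V) (env : V → ℕ) :
    (poly r e).eval env = r.eval (e.eval env) := by
  rw [Polynomial.eval_eq_sum_range, poly]
  generalize r.natDegree + 1 = m
  induction m with
  | zero => rfl
  | succ m ih =>
    rw [List.range_succ, List.foldr_append, Finset.sum_range_succ]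
    simp only [List.foldr_cons, List.foldr_nil]
    have : ∀ (l : List ℕ) (a : GExpr V),
        (l.foldr (fun i acc => GExpr.add (GExpr.mul (GExpr.const (r.coeff i)) (pow e i)) acc) a).eval env
          = (l.foldr (fun i acc => GExpr.add (GExpr.mul (GExpr.const (r.coeff i)) (pow e i)) acc)
              (GExpr.const 0)).eval env + a.eval env := by
      intro l a
      induction l with
      | nil => simp [GExpr.eval]
      | cons i l ihl => simp [GExpr.eval, ihl]; ring
    rw [this, ih]
    simp [GExpr.eval]

/-- Variables of a power expression. [folklore] -/
theorem vars_pow_subset (e : GExpr V) {v : V} : ∀ {i}, v ∈ (pow e i).vars → v ∈ e.vars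
  | 0, h => by simp [pow, GExpr.vars] at h
  | i + 1, h => by
    simp only [pow, GExpr.vars, List.mem_append] at h
    rcases h with h | h
    · exact vars_pow_subset e h
    · exact h

/-- Variables of a polynomial expression. [folklore] -/
theorem vars_poly_subset (r : Polynomial ℕ) (e : GExpr V) {v : V} (h : v ∈ (poly r e).vars) :
    v ∈ e.vars := by
  unfold poly at h
  revert h
  induction List.range (r.natDegree + 1) with
  | nil => intro h; simp [GExpr.vars] at h
  | cons i l ih =>
    intro h
    simp only [List.foldr_cons, GExpr.vars, List.nil_append, List.mem_append] at h
    rcases h with h | h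
    · exact vars_pow_subset e h
    · exact ih h

end GE

/-! ### The schema of the Cook–Levin clauses -/

/-- Counter variables of the Cook–Levin generator: input length, bit counter, row index, column
index, and the run index of literal emission. [folklore] -/
inductive CV where
  /-- the input length `n` -/
  | x0
  /-- the bit counter of the bit loop -/
  | cc
  /-- the row index `t` -/
  | ti
  /-- the column index `j` -/
  | ji
  /-- the run index of `varStmt` -/
  | rr
  deriving DecidableEq, Fintype

section Concrete

open Tableau Turing

variable (M : TM2ComputableAux Bool Bool) (p q : Polynomial ℕ)

/-- The certificate bound at input length `n`. [folklore] -/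
noncomputable def PP (n : ℕ) : ℕ := p.eval n

/-- The time bound at input length `n`: the machine's polynomial at the largest verifier input
length `N = 2n + 2 + P`. [folklore] -/
noncomputable def TT (n : ℕ) : ℕ := q.eval (NN n (PP p n))

/-- The number of block values. [folklore] -/
noncomputable def MMv : ℕ := Nat.card (Val M.tm)

/-- The index of a block value. [folklore] -/
noncomputable def idxV (v : Val M.tm) : ℕ := Finite.equivFin (Val M.tm) v

/-- The renaming of block variables into unary names. [folklore] -/
noncomputable def renM : TVar M → ℕ := Sch.ren (MMv M) (idxV M)

/-- The renaming is injective. [folklore] -/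
theorem renM_injective : Function.Injective (renM M) := by
  rintro ⟨b, v⟩ ⟨b', v'⟩ h
  have h1 : b * MMv M + idxV M v = b' * MMv M + idxV M v' := uname_injective h
  have hv : idxV M v < MMv M := (Finite.equivFin (Val M.tm) v).2
  have hv' : idxV M v' < MMv M := (Finite.equivFin (Val M.tm) v').2
  have hM : 0 < MMv M := Nat.zero_lt_of_lt hv
  have hi : idxV M v = idxV M v' := by
    have := congrArg (· % MMv M) h1
    simpa [Nat.mul_comm b, Nat.mul_comm b', Nat.mul_add_mod, Nat.mod_eq_of_lt hv,
      Nat.mod_eq_of_lt hv'] using this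
  have hb : b = b' := by
    have := congrArg (· / MMv M) h1
    simpa [Nat.mul_comm b, Nat.mul_comm b', Nat.mul_add_div hM, Nat.div_eq_of_lt hv,
      Nat.div_eq_of_lt hv'] using this
  subst hb
  have : v = v' := (Finite.equivFin (Val M.tm)).injective (Fin.ext hi)
  rw [this]

/-- **The Cook–Levin formula of `x`, over `ℕ`**: the tableau CNF with certificate bound `p(n)`
and time bound `q(N)`, its block variables renamed. [cite: Cook1971, Thm. 1] [cite: AroraBarakCC2009, Lemma 2.11] -/
noncomputable def chi (x : List Bool) : PropForm ℕ :=
  (tableau M (PP p x.length) (TT p q x.length) x).mapVars (renM M)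

/-- **The reduction**: `x ↦ encode (¬ χₓ)` (Arora–Barak 2009, Example 2.21: "consider the
formula `¬φₓ`"). [cite: AroraBarakCC2009, Example 2.21] -/
noncomputable def reduce (x : List Bool) : List Bool :=
  encodingPropForm.encode (PropForm.neg (chi M p q x))

/-! #### Counter expressions for the parameters -/

/-- `n`. [folklore] -/
def X0 : GExpr CV := GExpr.var CV.x0
/-- `P = p(n)`. [folklore] -/
noncomputable def PE : GExpr CV := GE.poly p X0
/-- `N = 2n + 2 + P`. [folklore] -/
noncomputable def NE : GExpr CV :=
  GExpr.add (GExpr.add (GExpr.mul (GExpr.const 2) X0) (GExpr.const 2)) (PE p)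
/-- `T = q(N)`. [folklore] -/
noncomputable def TE : GExpr CV := GE.poly q (NE p)
/-- `d`. [folklore] -/
noncomputable def dE : GExpr CV := GExpr.const (dM M)
/-- `S₁ = N + d T + 3 d`. [folklore] -/
noncomputable def SE : GExpr CV :=
  GExpr.add (GExpr.add (NE p) (GExpr.mul (dE M) (TE p q))) (GExpr.mul (GExpr.const 3) (dE M))
/-- `RB = S₁ + 1`. [folklore] -/
noncomputable def RE : GExpr CV := GExpr.add (SE M p q) (GExpr.const 1)
/-- The block number `t · RB + J`. [folklore] -/
noncomputable def blkE (t J : GExpr CV) : GExpr CV := GExpr.add (GExpr.mul t (RE M p q)) J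

section Eval

variable {M p q} {env : CV → ℕ} {n : ℕ} (hn : env CV.x0 = n)
include hn

/-- Value of `PE`. [folklore] -/
theorem eval_PE : (PE p).eval env = PP p n := by simp [PE, X0, GExpr.eval, hn, PP]
/-- Value of `NE`. [folklore] -/
theorem eval_NE : (NE p).eval env = NN n (PP p n) := by
  simp [NE, X0, GExpr.eval, hn, eval_PE hn, NN]
/-- Value of `TE`. [folklore] -/
theorem eval_TE : (TE p q).eval env = TT p q n := by simp [TE, eval_NE hn, TT]
/-- Value of `SE`. [folklore] -/
theorem eval_SE : (SE M p q).eval env = S1 M n (PP p n) (TT p q n) := by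
  simp [SE, dE, GExpr.eval, eval_NE hn, eval_TE hn, S1]
/-- Value of `RE`. [folklore] -/
theorem eval_RE : (RE M p q).eval env = RB M n (PP p n) (TT p q n) := by
  simp [RE, GExpr.eval, eval_SE hn, RB]
/-- Value of a block number expression. [folklore] -/
theorem eval_blkE (t J : GExpr CV) :
    (blkE M p q t J).eval env = blk M n (PP p n) (TT p q n) (t.eval env) (J.eval env) := by
  simp [blkE, GExpr.eval, eval_RE hn, blk]

end Eval

/-! #### The schema -/

local notation "W" => Val (TM2ComputableAux.tm M)

/-- Row `0` block `J`. [folklore] -/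
noncomputable def b0 (J : GExpr CV) : GExpr CV := blkE M p q (GExpr.const 0) J
/-- Row `t` block `J` (`t` the row index variable). [folklore] -/
noncomputable def bt (J : GExpr CV) : GExpr CV := blkE M p q (GExpr.var CV.ti) J
/-- Row `t + 1` block `J`. [folklore] -/
noncomputable def bt1 (J : GExpr CV) : GExpr CV :=
  blkE M p q (GExpr.add (GExpr.var CV.ti) (GExpr.const 1)) J
/-- `2 n + c`. [folklore] -/
def twoN (c : ℕ) : GExpr CV := GExpr.add (GExpr.mul (GExpr.const 2) X0) (GExpr.const c)

/-- Schema of the start clauses. [folklore] -/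
noncomputable def startS : Sch CV W :=
  Sch.seq (Sch.cls [([], [(b0 M p q (GExpr.const 0), ctrlVal M)]),
      ([], [(b0 M p q (twoN 1), symVal M false)]), ([], [(b0 M p q (twoN 2), symVal M true)])])
    (Sch.seq
      (Sch.loop CV.ji (PE p) (Sch.cls
        [([], [(b0 M p q (GExpr.add (twoN 3) (GExpr.var CV.ji)), symVal M false),
               (b0 M p q (GExpr.add (twoN 3) (GExpr.var CV.ji)), symVal M true),
               (b0 M p q (GExpr.add (twoN 3) (GExpr.var CV.ji)), noneVal M.tm)]),
         ([(b0 M p q (GExpr.add (twoN 3) (GExpr.var CV.ji)), noneVal M.tm)],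
          [(b0 M p q (GExpr.add (twoN 4) (GExpr.var CV.ji)), noneVal M.tm)])]))
      (Sch.loop CV.ji (GExpr.add (GExpr.mul (dE M) (TE p q)) (GExpr.mul (GExpr.const 3) (dE M)))
        (Sch.cls [([], [(b0 M p q (GExpr.add (GExpr.add (NE p) (GExpr.const 1)) (GExpr.var CV.ji)),
          noneVal M.tm)])])))

/-- Payload of the top clauses of a row. [folklore] -/
noncomputable def topL : List (ClauseE CV W) :=
  (allTuples M (3 * dM M + 1)).flatMap fun a =>
    (List.finRange (2 * dM M + 1)).map fun (r : Fin (2 * dM M + 1)) =>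
      ((List.finRange (3 * dM M + 1)).map fun (s : Fin (3 * dM M + 1)) =>
          (bt M p q (GExpr.const s), a s),
        [(bt1 M p q (GExpr.const r), topF (dM M) a r)])

/-- Payload of the interior clauses of a row and column. [folklore] -/
noncomputable def intL : List (ClauseE CV W) :=
  (allTuples M (dM M + 1)).flatMap fun h => (allTuples M (2 * dM M + 1)).map fun nb =>
    (((List.finRange (dM M + 1)).map fun (s : Fin (dM M + 1)) => (bt M p q (GExpr.const s), h s)) ++
      ((List.finRange (2 * dM M + 1)).map fun (s : Fin (2 * dM M + 1)) =>
        (bt M p q (GExpr.add (GExpr.add (GExpr.const (dM M + 1)) (GExpr.var CV.ji)) (GExpr.const s)),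
          nb s)),
     [(bt1 M p q (GExpr.add (GExpr.const (2 * dM M + 1)) (GExpr.var CV.ji)), intF (dM M) h nb)])

/-- Payload of the bottom clauses of a row. [folklore] -/
noncomputable def botL : List (ClauseE CV W) :=
  (List.range (dM M)).map fun r => ([], [(bt1 M p q (GExpr.add
    (GExpr.add (GExpr.add (GExpr.add (NE p) (GExpr.mul (dE M) (TE p q)))
      (GExpr.mul (GExpr.const 2) (dE M))) (GExpr.const 1)) (GExpr.const r)), noneVal M.tm)])

open scoped Classical in
/-- Payload of the exactly-one clauses of a block. [folklore] -/
noncomputable def cellL : List (ClauseE CV W) :=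
  ([], (allVals M).map fun v => (bt M p q (GExpr.var CV.ji), v)) ::
    ((allVals M).flatMap fun v => (allVals M).flatMap fun v' =>
      if v = v' then [] else [([(bt M p q (GExpr.var CV.ji), v), (bt M p q (GExpr.var CV.ji), v')], [])])

/-- **The schema of the clauses depending on `n` only** (same order as `Tableau.nClauses`).
[cite: Sipser2012, Thm. 7.37 (proof)] [folklore] -/
noncomputable def nS : Sch CV W :=
  Sch.seq (startS M p q)
    (Sch.seq (Sch.loop CV.ti (TE p q)
        (Sch.seq (Sch.cls (topL M p q))
          (Sch.seq (Sch.loop CV.ji (GExpr.add (NE p) (GExpr.mul (dE M) (TE p q))) (Sch.cls (intL M p q)))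
            (Sch.cls (botL M p q)))))
      (Sch.seq (Sch.loop CV.ti (GExpr.add (TE p q) (GExpr.const 1))
          (Sch.loop CV.ji (GExpr.add (SE M p q) (GExpr.const 1)) (Sch.cls (cellL M p q))))
        (Sch.cls [([], [(blkE M p q (TE p q) (GExpr.const 1), accVal M)])])))

/-- The schema of the two clauses of an input bit. [folklore] -/
noncomputable def bitS (b : Bool) : Sch CV W :=
  Sch.cls [([], [(b0 M p q (GExpr.add (GExpr.mul (GExpr.const 2) (GExpr.var CV.cc)) (GExpr.const 1)),
      symVal M b)]),
    ([], [(b0 M p q (GExpr.add (GExpr.mul (GExpr.const 2) (GExpr.var CV.cc)) (GExpr.const 2)),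
      symVal M b)])]

/-! #### The schema computes the clause families -/

section ClausesEq

variable {M p q} {n : ℕ}

local notation "P" => PP p n
local notation "T" => TT p q n

/-- Value of a row-`0` block expression. [folklore] -/
theorem eval_b0 {env : CV → ℕ} (hn : env CV.x0 = n) (J : GExpr CV) :
    (b0 M p q J).eval env = blk M n P T 0 (J.eval env) := by
  rw [b0, eval_blkE hn]; rfl

/-- Value of a row-`t` block expression. [folklore] -/
theorem eval_bt {env : CV → ℕ} (hn : env CV.x0 = n) (J : GExpr CV) :
    (bt M p q J).eval env = blk M n P T (env CV.ti) (J.eval env) := by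
  rw [bt, eval_blkE hn]; rfl

/-- Value of a row-`t + 1` block expression. [folklore] -/
theorem eval_bt1 {env : CV → ℕ} (hn : env CV.x0 = n) (J : GExpr CV) :
    (bt1 M p q J).eval env = blk M n P T (env CV.ti + 1) (J.eval env) := by
  rw [bt1, eval_blkE hn]; rfl

/-- A `flatMap` of singletons is a `map` (Mathlib's `List.map_eq_flatMap`, reversed).
[folklore] -/
theorem flatMap_singleton_eq_map {α β : Type} (l : List α) (f : α → β) :
    (l.flatMap fun x => [f x]) = l.map f :=
  List.map_eq_flatMap.symm

/-- Mapping over a conditional list (`apply_ite` for `List.map`). [folklore] -/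
theorem map_ite {α β : Type} (c : Prop) [Decidable c] (f : α → β) (a b : List α) :
    (if c then a else b).map f = if c then a.map f else b.map f :=
  apply_ite (List.map f) c a b

variable (env : CV → ℕ) (hn : env CV.x0 = n)
include hn

/-- The start schema computes the start clauses. [folklore] -/
theorem clauses_startS : (startS M p q).clauses env = startClauses M n P T := by
  have hji : ∀ k, Function.update env CV.ji k CV.x0 = n := fun k => by
    rw [Function.update_of_ne (by decide)]; exact hn
  simp only [startS, Sch.clauses, Sch.evalCl, List.map_cons, List.map_nil, startClauses,
    eval_PE hn, eval_b0 hn, eval_b0 (hji _), GExpr.eval, twoN, X0, hn, hji, dE,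
    eval_NE (hji _), eval_TE hn, Function.update_self, flatMap_singleton_eq_map, List.append_assoc]

/-- The top payload computes the top clauses of row `env t`. [folklore] -/
theorem clauses_topL : (topL M p q).map (Sch.evalCl env) = topClauses M n P T (env CV.ti) := by
  simp only [topL, topClauses, List.map_flatMap, List.map_map, Function.comp_def, Sch.evalCl,
    eval_bt hn, eval_bt1 hn, GExpr.eval, List.map_cons, List.map_nil]

/-- The interior payload computes the interior clauses of row `env t`, column `env j`. [folklore] -/
theorem clauses_intL :
    (intL M p q).map (Sch.evalCl env) = intClauses M n P T (env CV.ti) (env CV.ji) := by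
  simp only [intL, intClauses, List.map_flatMap, List.map_map, Function.comp_def, Sch.evalCl,
    eval_bt hn, eval_bt1 hn, GExpr.eval, List.map_cons, List.map_nil, List.map_append]

/-- The bottom payload computes the bottom clauses of row `env t`. [folklore] -/
theorem clauses_botL : (botL M p q).map (Sch.evalCl env) = botClauses M n P T (env CV.ti) := by
  simp only [botL, botClauses, List.map_map, Function.comp_def, Sch.evalCl, eval_bt1 hn,
    GExpr.eval, List.map_cons, List.map_nil, dE, eval_TE hn, eval_NE hn]

/-- The cell payload computes the exactly-one clauses of block `(env t, env j)`. [folklore] -/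
theorem clauses_cellL :
    (cellL M p q).map (Sch.evalCl env) = cellClauses M n P T (env CV.ti) (env CV.ji) := by
  classical
  simp only [cellL, cellClauses, List.map_cons, List.map_flatMap, map_ite, List.map_nil,
    Sch.evalCl, List.map_map, Function.comp_def, eval_bt hn, GExpr.eval]
  congr 1
  refine List.flatMap_congr fun v _ => List.flatMap_congr fun v' _ => ?_
  by_cases h : v = v' <;> simp [h]

/-- **The schema `nS` computes `nClauses`.** [folklore] -/
theorem clauses_nS : (nS M p q).clauses env = nClauses M n P T := by
  have hti : ∀ k, Function.update env CV.ti k CV.x0 = n := fun k => by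
    rw [Function.update_of_ne (by decide)]; exact hn
  have htj : ∀ k k', Function.update (Function.update env CV.ti k) CV.ji k' CV.x0 = n :=
    fun k k' => by rw [Function.update_of_ne (by decide)]; exact hti k
  simp only [nS, Sch.clauses, clauses_startS env hn, clauses_topL _ (hti _), clauses_intL _ (htj _ _),
    clauses_botL _ (hti _), clauses_cellL _ (htj _ _), nClauses, eval_TE hn, eval_TE (hti _),
    eval_NE (hti _), eval_SE (hti _), GExpr.eval, dE, Function.update_self,
    Function.update_of_ne, ne_eq, reduceCtorEq, not_false_eq_true, List.append_assoc,
    Sch.evalCl, List.map_cons, List.map_nil, eval_blkE hn]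

/-- The bit schema computes the bit clauses of bit counter `env c`. [folklore] -/
theorem clauses_bitS (b : Bool) : (bitS M p q b).clauses env = bitClauses M n P T b (env CV.cc) := by
  simp only [bitS, Sch.clauses, Sch.evalCl, List.map_cons, List.map_nil, bitClauses, eval_b0 hn,
    GExpr.eval]

end ClausesEq

/-! #### The generator statements and the stream identity -/

/-- The size expression: `|¬χₓ| = 8 n + Σ_{n-clauses} (|clause formula| + 1) + 2`. [folklore] -/
noncomputable def sizeExpr : GExpr CV :=
  GExpr.add (GExpr.add (GExpr.mul (GExpr.const 8) X0) ((nS M p q).sizeE)) (GExpr.const 2)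

/-- First part of the output: the doubled unary size and the separator of `encodingPropForm`,
then the tag `10` of `¬`. [folklore] -/
noncomputable def P1 : GStmt CV Bool :=
  GStmt.seq (GStmt.loop CV.rr (sizeExpr M p q) (GStmt.emit [true, true]))
    (GStmt.emit [false, true, true, false])

/-- Last part of the output: the conjuncts of the `n`-clauses, then the code `011` of the final
`⊤` of the big conjunction. [folklore] -/
noncomputable def P3 : GStmt CV Bool :=
  GStmt.seq ((nS M p q).stmt (MMv M) (idxV M) CV.rr) (GStmt.emit [false, true, true])

/-- The bit-loop bodies: the conjuncts of the two clauses of an input bit. [folklore] -/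
noncomputable def stb (b : Bool) : GStmt CV Bool := (bitS M p q b).stmt (MMv M) (idxV M) CV.rr

variable {M p q}

/-- Variables of `PE`: the input length only. [folklore] -/
theorem vars_PE {v : CV} (h : v ∈ (PE p).vars) : v = CV.x0 := by
  simpa [X0, GExpr.vars] using GE.vars_poly_subset p X0 h

/-- Variables of `NE`: the input length only. [folklore] -/
theorem vars_NE {v : CV} (h : v ∈ (NE p).vars) : v = CV.x0 := by
  simp only [NE, X0, GExpr.vars, List.mem_append, List.mem_singleton, List.not_mem_nil,
    or_false, false_or] at h
  rcases h with h | h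
  · exact h
  · exact vars_PE h

/-- Variables of `TE`: the input length only. [folklore] -/
theorem vars_TE {v : CV} (h : v ∈ (TE p q).vars) : v = CV.x0 := vars_NE (GE.vars_poly_subset q _ h)

/-- Variables of `SE`: the input length only. [folklore] -/
theorem vars_SE {v : CV} (h : v ∈ (SE M p q).vars) : v = CV.x0 := by
  simp only [SE, dE, GExpr.vars, List.mem_append, List.not_mem_nil, or_false, false_or] at h
  rcases h with h | h
  · exact vars_NE h
  · exact vars_TE h

/-- The loop bounds of `nS` mention the input length only. [folklore] -/
theorem boundsFree_nS : (nS M p q).BoundsFree (· = CV.x0) := by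
  have hP : ∀ v ∈ (PE p).vars, v = CV.x0 := fun v h => vars_PE h
  have hT : ∀ v ∈ (TE p q).vars, v = CV.x0 := fun v h => vars_TE h
  have hS : ∀ v ∈ (SE M p q).vars, v = CV.x0 := fun v h => vars_SE h
  have hNT : ∀ v, v ∈ (NE p).vars ∨ v ∈ (TE p q).vars → v = CV.x0 :=
    fun v h => h.elim vars_NE vars_TE
  have h0 : ∀ v : CV, False → v = CV.x0 := fun _ h => h.elim
  simp only [nS, startS, Sch.BoundsFree, Sch.sizeE, GExpr.vars, dE, List.mem_append,
    List.not_mem_nil, or_false, false_or, true_and, and_true]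
  exact ⟨⟨⟨by decide, hP, h0⟩, by decide, hT, h0⟩, ⟨by decide, hT, hNT, by decide, hNT, h0⟩,
    by decide, hT, hS, by decide, hS, h0⟩

/-- `nS` is well formed for compilation. [folklore] -/
theorem ok_nS : (nS M p q).ok CV.rr := by
  simp [nS, startS, Sch.ok, Sch.idxs]

/-- Sizes of the bit clauses: `8` per bit. [folklore] -/
theorem sum_size_xClauses (n Pn Tn : ℕ) : ∀ (x : List Bool) (m : ℕ),
    (((x.zipIdx m).flatMap fun bi => bitClauses M n Pn Tn bi.1 bi.2).map
      fun cl => (clauseForm (HClause.toClause cl)).size + 1).sum = 8 * x.length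
  | [], m => rfl
  | b :: x, m => by
    rw [List.zipIdx_cons, List.flatMap_cons, List.map_append, List.sum_append,
      sum_size_xClauses n Pn Tn x (m + 1)]
    simp [bitClauses, size_clauseForm_toClause]
    ring

/-- **The size of `¬χₓ` is the value of the size expression.** [folklore] -/
theorem size_neg_chi (x : List Bool) :
    (PropForm.neg (chi M p q x)).size = (sizeExpr M p q).eval (GenProg.initEnv CV.x0 x.length) := by
  have hn : GenProg.initEnv CV.x0 x.length CV.x0 = x.length := GenProg.initEnv_self _ _
  rw [PropForm.size, chi, PropForm.size_mapVars, tableau, tableauCNF, HClause.cnfOf, size_ofCNF,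
    List.map_map, clauses, List.map_append, List.sum_append, xClauses]
  rw [show ((x.zipIdx.flatMap fun bi => bitClauses M x.length (PP p x.length) (TT p q x.length)
      bi.1 bi.2).map ((fun c => (clauseForm c).size + 1) ∘ HClause.toClause)).sum = 8 * x.length from
    sum_size_xClauses _ _ _ x 0, ← clauses_nS _ hn,
    show (((nS M p q).clauses (GenProg.initEnv CV.x0 x.length)).map
      ((fun c => (clauseForm c).size + 1) ∘ HClause.toClause)).sum = _ from
      Sch.sum_size_clauses boundsFree_nS _]
  simp [sizeExpr, GExpr.eval, X0]

/-- **The code of `χₓ`**: the conjunct codes of all clauses, then `011`. [folklore] -/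
theorem code_chi (x : List Bool) :
    (chi M p q x).code = (clauses M (PP p x.length) (TT p q x.length) x).flatMap
      (Sch.clCode (MMv M) (idxV M)) ++ [false, true, true] := by
  rw [chi, tableau, tableauCNF, HClause.cnfOf, mapVars_ofCNF, code_ofCNF, List.map_map,
    List.flatMap_map]
  rfl

/-- Runs of `11`. [folklore] -/
theorem flatMap_range_tt2 (N : ℕ) :
    ((List.range N).flatMap fun _ => [true, true]) = List.replicate (2 * N) true := by
  induction N with
  | zero => rfl
  | succ N ih =>
    rw [List.range_succ, List.flatMap_append, ih, show 2 * (N + 1) = 2 * N + 1 + 1 by ring,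
      List.replicate_succ', List.replicate_succ']
    simp

/-- **The bit loop emits the conjuncts of the bit clauses.** [folklore] -/
theorem bitsOut_eq (x : List Bool) : ∀ (z : List Bool) (m : ℕ),
    GenProg.bitsOut (GenProg.initEnv CV.x0 x.length) CV.cc (stb M p q true) (stb M p q false) z m =
      ((z.zipIdx m).flatMap fun bi => bitClauses M x.length (PP p x.length) (TT p q x.length)
        bi.1 bi.2).flatMap (Sch.clCode (MMv M) (idxV M))
  | [], m => rfl
  | b :: z, m => by
    have hn : Function.update (GenProg.initEnv CV.x0 x.length) CV.cc m CV.x0 = x.length := by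
      rw [Function.update_of_ne (by decide)]; exact GenProg.initEnv_self _ _
    rw [GenProg.bitsOut, bitsOut_eq x z (m + 1), List.zipIdx_cons, List.flatMap_cons,
      List.flatMap_append]
    congr 1
    cases b <;> simp only [cond_true, cond_false, stb, Sch.out_stmt, clauses_bitS _ hn,
      Function.update_self]

/-- Mathlib's formula code. [folklore] -/
theorem encodingPropForm_encode (φ : PropForm ℕ) :
    encodingPropForm.encode φ = boolPair (unaryEncodeNat φ.size) φ.code := rfl

/-- **The stream identity**: the generator with input access emits exactly `encode (¬χₓ)`.
[cite: AroraBarakCC2009, Lemma 2.11] -/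
theorem outI_eq_reduce (x : List Bool) :
    GenProg.outI CV.x0 CV.cc (P1 M p q) (P3 M p q) (stb M p q true) (stb M p q false) x =
      reduce M p q x := by
  have hn : GenProg.initEnv CV.x0 x.length CV.x0 = x.length := GenProg.initEnv_self _ _
  rw [reduce, encodingPropForm_encode, unaryEncodeNat_eq_replicate, boolPair_replicate_true,
    size_neg_chi, PropForm.code, code_chi, GenProg.outI, bitsOut_eq, clauses, xClauses]
  simp only [P1, P3, GStmt.out, flatMap_range_tt2, Sch.out_stmt, clauses_nS _ hn,
    List.flatMap_append, List.append_assoc, List.cons_append, List.nil_append]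

/-! #### Polynomial time -/

/-- Loop indices of the bit-loop bodies. [folklore] -/
theorem loopVars_stb {v : CV} (b : Bool) (h : v ∈ (stb M p q b).loopVars) : v = CV.rr := by
  rcases Sch.mem_loopVars_stmt _ _ _ h with h | h
  · exact h
  · simp [bitS, Sch.idxs] at h

/-- Loop indices of `P3`. [folklore] -/
theorem loopVars_P3 {v : CV} (h : v ∈ (P3 M p q).loopVars) : v = CV.rr ∨ v = CV.ti ∨ v = CV.ji := by
  simp only [P3, GStmt.loopVars, List.append_nil] at h
  rcases Sch.mem_loopVars_stmt _ _ _ h with h | h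
  · exact Or.inl h
  · revert h
    cases v <;> simp [nS, startS, Sch.idxs]

/-- The variable conditions of the Cook–Levin generator. [folklore] -/
theorem wfI : GenProg.WfI CV.x0 CV.cc (P1 M p q) (P3 M p q) (stb M p q true) (stb M p q false) where
  ne := by decide
  x₀_P₁ := by simp [P1, GStmt.loopVars]
  x₀_P₃ h := by rcases loopVars_P3 h with h | h | h <;> cases h
  x₀_st h := by cases loopVars_stb _ h
  x₀_sf h := by cases loopVars_stb _ h
  c_P₁ := by simp [P1, GStmt.loopVars]
  c_P₃ h := by rcases loopVars_P3 h with h | h | h <;> cases h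
  c_st h := by cases loopVars_stb _ h
  c_sf h := by cases loopVars_stb _ h
  nr_P₁ := by simp [P1, GStmt.noReuse, GStmt.loopVars]
  nr_P₃ := by
    simp only [P3, GStmt.noReuse, Bool.and_true]
    exact Sch.noReuse_stmt _ _ _ ok_nS
  nr_st := Sch.noReuse_stmt _ _ _ trivial
  nr_sf := Sch.noReuse_stmt _ _ _ trivial

variable (M p q) in
/-- **The reduction is polynomial-time computable**: `(x ↦ encode (¬χₓ)) ∈ FP`, by the generator
with input access (`GenProg.outI_mem_FP`) and the stream identity (Arora–Barak 2009, proof of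
Lemma 2.11: "this CNF formula can be computed in time polynomial in the running time of `M`").
[cite: AroraBarakCC2009, Lemma 2.11 (proof)] -/
theorem reduce_mem_FP : reduce M p q ∈ FP := by
  have he : reduce M p q =
      GenProg.outI CV.x0 CV.cc (P1 M p q) (P3 M p q) (stb M p q true) (stb M p q false) :=
    funext fun x => (outI_eq_reduce (M := M) (p := p) (q := q) x).symm
  rw [he]
  exact GenProg.outI_mem_FP (V := CV) CV.x0 CV.cc (P1 M p q) (P3 M p q) (stb M p q true)
    (stb M p q false) (wfI (M := M) (p := p) (q := q))

/-! ### The reduction is correct; coNP-hardness of `TAUT` -/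

/-- `¬φ` is a tautology iff `φ` is unsatisfiable. [Cook 1971, §1] [folklore] -/
theorem isTautology_neg_iff (φ : PropForm ℕ) : (PropForm.neg φ).IsTautology ↔ ¬ φ.Satisfiable := by
  simp [PropForm.IsTautology, PropForm.Satisfiable, PropForm.eval]

variable (M p q) in
/-- **Correctness of the reduction**: if `M` computes `f` within time `q`, then `reduce x ∈ TAUT`
iff no certificate `u` with `|u| ≤ p(|x|)` has `f ⟨x, u⟩ = true` (Cook 1971, Thm. 1;
Arora–Barak 2009, Thm. 2.10 with Example 2.21). [cite: Cook1971, Thm. 1] [cite: AroraBarakCC2009, Example 2.21] -/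
theorem reduce_mem_TAUT_iff {f : List Bool → Bool}
    (hM : ∀ a : List Bool, M.OutputsWithin a [f a] (q.eval a.length)) (x : List Bool) :
    reduce M p q x ∈ TAUT ↔ ¬ ∃ u : List Bool, u.length ≤ p.eval x.length ∧ f (boolPair x u) = true := by
  rw [reduce, mem_TAUT_iff, isTautology_neg_iff, chi]
  have hrun : ∀ u : List Bool, u.length ≤ PP p x.length →
      M.OutputsWithin (boolPair x u) [f (boolPair x u)] (TT p q x.length) := fun u hu =>
    (hM (boolPair x u)).mono (TM2Iter.eval_mono q (by rw [length_boolPair, NN, PP] at *; omega))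
  rw [show ((tableau M (PP p x.length) (TT p q x.length) x).mapVars (renM M)).Satisfiable ↔
      (tableau M (PP p x.length) (TT p q x.length) x).Satisfiable from
    ⟨PropForm.Satisfiable.of_mapVars _, PropForm.Satisfiable.mapVars (renM_injective M)⟩,
    satisfiable_tableau_iff x _ _ hrun]
  rfl

end Concrete

open scoped Notation

/-- **Cook–Levin for `TAUT`: every language in `coNP` Karp-reduces to `TAUT`** (`IsHard coNP TAUT`;
Cook 1971, Thm. 1 — every NP language reduces to the DNF tautologies; Arora–Barak 2009,
Example 2.21 — `TAUTOLOGY` is coNP-complete via `x ↦ ¬φₓ`; Sipser 2012, Thm. 7.37). For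
`L ∈ coNP`, `Lᶜ ∈ NP = polyExists P` gives `L' ∈ P` and `p`; `mem_P_iff_holds` gives a
`FinTM2` decider `M` of `L'` with polynomial time `q`; the reduction is `reduce M p q`, in `FP`
by `reduce_mem_FP` and correct by `reduce_mem_TAUT_iff`. [cite: Cook1971, Thm. 1]
[cite: AroraBarakCC2009, Example 2.21] -/
theorem isHard_coNP_TAUT_holds : IsHard coNP TAUT := by
  intro L hL
  have hL1 : Lᶜ ∈ polyExists Classes.P := hL
  obtain ⟨L', hL', p, hp⟩ := hL1
  obtain ⟨q, Mx, hM⟩ := mem_P_iff_holds.1 hL'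
  refine ⟨reduce Mx p q, reduce_mem_FP Mx p q, fun x => ?_⟩
  refine Iff.trans ?_ (reduce_mem_TAUT_iff Mx p q
    (f := fun a => (L' : Set (List Bool)).boolIndicator a) (fun a => hM a) x).symm
  have hc : x ∈ L ↔ ¬ x ∈ Lᶜ := ⟨fun h hc => hc h, fun h => Classical.not_not.1 h⟩
  refine hc.trans (not_congr ((hp x).trans (exists_congr fun u => and_congr Iff.rfl ?_)))
  exact Set.mem_iff_boolIndicator (L' : Set (List Bool)) (boolPair x u)

end CookLevin

end Literature.Computability.Complexity
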